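import Literature.MathematicalPhysics.QuantumFieldTheory.Balaban1983to89.B9Thm39FacesAtLettersRC
import Literature.MathematicalPhysics.QuantumFieldTheory.Balaban1983to89.B9Conv348OfRegYP335AtLettersY
import Literature.MathematicalPhysics.QuantumFieldTheory.Balaban1983to89.B9SectionCarryingMembersV1

/-!
# `Balaban1983to89.B9Thm39FacesAlongSubfamilyRC` — rows 15–16 of the N06 knit ([B9] Theorem 3.9 ⇒ Theorem 3.2) ALONG A SUB-FAMILY `f : J → MemberY`:
# the «J-indexed rows face» (display `h348` only at the members `f j`, pin at the certificate's OWN (2.61) constants), and the SAME WITH `h348`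
# DISCHARGED along every SECTION-CARRYING sub-family `(f, ιB, hι)` — rows 15 ∧ 16 and Theorem 3.2 as THEOREMS there, at `SCMemberY` by name

T. Bałaban, *Propagators for lattice gauge theories in a background field*, Commun. Math. Phys. **99** (1985) 389–434
[`Balaban1985BackgroundPropagators`, "B9"]; [4] = T. Bałaban, *Propagators and renormalization transformations for lattice gauge theories. II*,
Commun. Math. Phys. **96** (1984) 223–250 [`Balaban1984PropagatorsII`].

statement-level skeleton of published theorems with citation tags; proofs where landed; nothing here is a claim about the Yang–Mills mass gap

THE PRINTED LOCI (verbatim).  p. 398, Theorem 3.2: *«|(Q′(U)G′²(U)Q′\*(U))⁻¹(y, y′)| ≦ B₀(Lʲη)⁻⁴(L^{j′}η)^{−d}e^{−δ₀d(y,y′)}, y, y′ ∈ 𝔅»* (3.48);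
p. 413, Theorem 3.9 (3.98)–(3.99): *«… This theorem implies Theorem 3.2.»*; p. 396 (3.35): *«… for a cube □ ∈ 𝒞ⱼ of side cLʲη, c a number ≧ 10»*;
[4] p. 234, Lemma 2.1 (2.61): *«sup_{y∈𝔅} Σ_{y′∈𝔅} e^{−αδ₀d(y,y′)} ≦ c₁(α)»*; [4] p. 231 (2.45), p. 248 *«sites replaced by bonds»*.

WHY THIS FILE (cell context, 2026-08-29; dag-n06-d's `DISPLAY-LEDGER-UF.md` §2, rows 15–16).  The N06 certificate of record (edition 79 «UF»,
`Thm/BalabanUVNodesN06AtOpsYNuOfRecordV6EPairUF`) displays rows 15–16's ONE letter schema `h348 : ∀ x : MemberY …, … → Conv348Blk (oneCubeOps39YF … bI x) B39 δ39 U`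
over the WHOLE member type and consumes it through this seat's face `B9Thm39FacesAtLettersRC.t39_hksum_oneCube_opsYOfLetters_FRC`, whose conclusion
(`B9.Thm39Printed … geo9Y …`, MemberY-indexed) the coded knit `B9LeafXCodedKnitU.b9LeafX_carriersYU` then RE-INDEXES along the (α3) sub-family `f : J → MemberY`
(`thm39Printed_reindex f`, `thm32Printed_reindex f`) — the leaf `B9LeafX (carriersYU … f …)` is `J`-indexed (`carriersYU_I9 : I9 = J`).  This seat's g31 theorem
`B9Conv348OfRegYP335AtLettersY.conv348_oneCubeYF_of_regYR_section` SUPPLIES the display at every SECTION-CARRYING member, and the (α3) block's members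
`f j` CARRY sections `(ιB j, hι j)`; but the display is not foldable while the face is typed over all of `MemberY` (inner-corner members exist —
`B9BetaNotchMemberV1`, `Node00.MemberYCornered`).  The ledger's named remover is «a J-indexed rows face (re-index rows 15–16 along `f`)».  THIS FILE is the
n06-j side of it:
* §1 (generic index `I`) `thm39_and_kernelSum_of_pin_constBlkViaDatum` — rows 15 ∧ 16 at the datum read through `π` with the (2.61) constants GIVEN
  (`c₀, c₀′` above a threshold `ML`), i.e. `B9Thm39WholeBlkViaDatum.thm39_and_kernelSum_of_pin_rowConst261BlkViaDatum` with the definite constant of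
  THE family replaced by any admissible pair — so that a SUB-family can be run at the constants of the BIG family (`rowConst261` is by choice and
  family-dependent; the certificate's `𝔈`-pin names `rowConst261 geo9Y (α′r)`).
* §2 `ineq261_pair_geo9Y_along` (the record family's definite (2.61) constants serve every sub-family `geo9Y ∘ f`); ★★ `t39_hksum_oneCube_opsYOfLetters_FRC_along`
  — THE J-INDEXED ROWS FACE: `t39_hksum_oneCube_opsYOfLetters_FRC` with `h348` and the `𝔈`-pin asked ONLY at the members `f j`, SAME pin constants
  `(2·(1·B₀)·rowConst261 geo9Y (α′r), (1−α′)r)`, conclusion `B9.Thm39Printed (θ.d₆+1) c (geo9Y ∘ f) (bg9YR … R₁ R₂ ∘ f) (EK39 ∘ f) ∧ B9.RWKernelSumYields …`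
  (what `thm39Printed_reindex f` hands the knit today); `thm32_oneCube_opsYOfLetters_FRC_along` (Theorem 3.2 along `f` — the knit's `h32J` directly).
* §3 ★★★ `t39_hksum_along_sections_of_regYR` — THE SAME WITH `h348` DISCHARGED: for every regularity pair `(R₁, R₂)` landing in print's class (the certificate's
  own transfer `hRP1`) and every `c > 0` there are `B₀, δ₀ > 0` such that for all rates `0 < α′ < 1`, `0 < r ≦ δ₀`, every residual letter `𝔯`, every `𝔈` pinned
  at those constants along `f`, every bond map `bI` with n06-i's `hβI`, and EVERY SECTION-CARRYING SUB-FAMILY `(f, ιB, hι)`: rows 15 ∧ 16 HOLD along `f` at class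
  constant `c` — no `h348`, no regime letters `M39 a39`; ★★★ `thm32_along_sections_of_regYR` (Theorem 3.2 along `f`).
* §4 at n06-c's carrier BY NAME (director-ym №300 «INHABITED BY:» `SCMemberY.nonempty` ∕ `exists_scMember_ge`): ★★★ `t39_hksum_at_scMemberY_of_regYR`,
  `thm32_at_scMemberY_of_regYR` (`J := SCMemberY …`, `f := SCMemberY.val`, `ιB := SCMemberY.ιBsc`, `hι := SCMemberY.hιsc`).

KNIT SIDE (not done here; the knit owner's call).  A `J`-indexed edition feeds `t39 ∕ hksum` to a twin of `b9LeafX_carriersYU` taking the two leaves ALREADY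
along `f` (its `h32J := B9.thm32_of_thm39 … t39J hksumJ`, `thm39Printed_coded … t39J` — no `_reindex`), and the two (3.49) faces that also read `h348`
(`proj349Maj_of_t37_display348_rateR_ge`, `s349_site_of_t37_display348_of_R`) want the same re-indexing; then `h348` is displayed `J`-indexed and DISCHARGED at
the (α5) instantiation `J := SCMemberY` by §4, or replaced outright by §3 with `B39, δ39` the witnesses here.

HONEST SCOPE.  §1–§2 are the landed rows-15–16 route re-typed along a sub-family (every estimate is the landed one: `thm39Printed_of_local348BlkVia`,
`rwKernelSumYields_of_conv348BlkVia`, `kerReadsLeVia_opsYOfLettersR_F`, `rowSum261_geo9Y`); §3–§4 compose them with the g31 theorem (lit-balaban's Theorem 3.2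
member assembler behind it).  Nothing of [B9] or [4] is newly asserted; rows 15 ∧ 16 become theorems ALONG SECTION-CARRYING SUB-FAMILIES ONLY — at inner-corner
members the display stays displayed (lit-balaban's section binder `hι`, iface IR-N06-SECTION); NOT a node discharge, NOT summit progress; count-neutral; one
finite 𝕋⁴ programme, nothing continuum, nothing about the mass gap.  Cell `pub-ymgap` (HUMAN RULING D-0062), node N06 [B9], seat `pub-ymgap-dag-n06-j`
(harness re-seat gen 32), 2026-08-29.  No `sorry`, no `axiom`, no `instance`, no `notation`, no `def`.  NEW file; nothing landed is modified.
-/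

noncomputable section

namespace Literature.MathematicalPhysics.QuantumFieldTheory.Balaban1983to89.B9Thm39FacesAlongSubfamilyRC

open Literature.MathematicalPhysics.QuantumFieldTheory.Balaban1983to89
open Finset B6RandomWalk B9Thm39Whole B9Thm39WholeBlk B9Thm39WholeBlkVia B9Thm39WholeBlkViaDatum B9Thm39ReadingCoords B9Thm39ReadingAtLetters
  B9Thm39ReadingFaithful B9Thm39Thm311AtLettersR B9Thm39OneCubeReadingAtLettersY B9Thm39PureGaugeClassAtLettersR B9Thm39FacesAtLettersRC Node00
open B6KLevelCensusIndexV1 B6Geom246MultiLevelBox B6Geom246MultiLevelTorus B6Ineq2142KLevelV1 B6GlobalChartV1 B9PinMembersKLevelV1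
  B9PinCarriersKLevelV1 B9PinGeometryKLevelV1 B7Prop2SpecialUnitary B9Ineq349SiteFromConv348 B9BackgroundsKLevelV1R B9BackgroundsKLevelV1P
  B9GeoLemma21KLevelV1 B6Lemma21Repaired B9Thm34Ext
open Literature.MathematicalPhysics.QuantumFieldTheory.Balaban1983to89.B9Conv348OfRegYP335AtLettersY (conv348_oneCubeYF_of_regYR_section)
open Literature.MathematicalPhysics.QuantumFieldTheory.Balaban1983to89.B9SectionCarryingMembersV1 (SCMemberY)

/-! ## §1 Rows 15 ∧ 16 at the datum read through `π`, the (2.61) constants GIVEN (generic index) -/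

section Family

variable {I : Type} {c35 : ℝ} {geo : I → B9.Geometry} {bg : I → B9.Backgrounds}
variable [∀ i, Fintype (geo i).Site] [∀ i, DecidableEq (geo i).Site]
variable {X ι κ : I → Type} [∀ i, Fintype (ι i)] [∀ i, Fintype (X i)] [∀ i, DecidableEq (X i)]

/-- **ROWS 15 ∧ 16 AT THE DEFINITE DATUM READ THROUGH `π`, THE (2.61) CONSTANTS GIVEN**: as
`B9Thm39WholeBlkViaDatum.thm39_and_kernelSum_of_pin_rowConst261BlkViaDatum`, but [4] Lemma 2.1 (2.61) is supplied at the two rates `αδ₀`, `α′r` by ANY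
constants `c₀, c₀′ ≧ 0` above a threshold `ML` (`h261`), and the pinned kernel-expansion datum carries `c₀′`: `B9.Thm39Printed d c₃₅ geo bg EK ∧
B9.RWKernelSumYields d geo bg EK Cinv`.  (So a sub-family may be run at the constants chosen for a bigger family.)
[cite: Balaban1985BackgroundPropagators, Thm 3.9 (3.98)–(3.99) p.413 + Thm 3.2 (3.48) p.398 + (3.96) p.411; Balaban1984PropagatorsII, Lemma 2.1 (2.61) p.234 + (2.51) p.232 + p.248] -/
theorem thm39_and_kernelSum_of_pin_constBlkViaDatum (𝔬 : ∀ i, Ops39Blk (geo i) (bg i) (X i) (ι i) (κ i))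
    (rd : ∀ i, WalkReading39 (bg i) (ι i) (κ i)) (Cinv : ∀ i, B9.SiteKernel (geo i) (bg i)) (d : ℕ)
    (π : ∀ i, (geo i).Site → (geo i).Site) (c₀ c₀' α α' r δ₀ θ₀ B₀ N a₁ M₁ ML cR : ℝ)
    (hc₀ : 0 ≤ c₀) (hc₀' : 0 ≤ c₀') (h35 : 0 < c35) (hα : 0 < α) (hα1 : α < 1) (hα'1 : α' < 1) (hr : 0 < r)
    (hrδ : r ≤ δ₀) (hθ₀ : 0 ≤ θ₀) (hB₀ : 0 < B₀) (hN : 0 ≤ N) (ha₁ : 0 < a₁) (hM₁ : 0 < M₁) (hcR : 0 ≤ cR)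
    (hst : ∀ i, StaticOK39Blk (𝔬 i) N) (hloc : ∀ i, Locality39Blk (𝔬 i) (rd i))
    (hπlen : ∀ (i : I) (y : (geo i).Site), (geo i).len (π i y) = (geo i).len y)
    (hπl : ∀ (i : I) (y z : (geo i).Site), (geo i).dist (π i y) z = (geo i).dist y z)
    (hπr : ∀ (i : I) (z y : (geo i).Site), (geo i).dist z (π i y) = (geo i).dist z y)
    (h261 : ∀ i, ML ≤ (geo i).M → Ineq261With c₀ (b6 (geo i)) δ₀ α ∧ Ineq261With c₀' (b6 (geo i)) r α')
    (hrd : ∀ i, KerReadsLeVia (𝔬 i) (Cinv i) d cR (π i))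
    (h39 : ∀ i, M₁ ≤ (geo i).M → ∀ α₀ : ℝ, 0 < α₀ → c35 * (geo i).M * α₀ ≤ a₁ →
      ∀ U : (bg i).Cfg, (bg i).Reg335 c35 α₀ U →
        Local348Blk (𝔬 i) B₀ δ₀ U ∧ Identities395Blk (𝔬 i) U ∧ Small285Blk (𝔬 i) θ₀ r U ∧ Factors389Blk (𝔬 i) θ₀ δ₀ U)
    {EK : ∀ i, B9.RWKernelExpansion (geo i) (bg i)}
    (hEK : ∀ i, EK i = EK39OfOpsBlkVia (𝔬 i) (rd i) d (2 * (N * B₀) * c₀') ((1 - α') * r) (π i)) :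
    B9.Thm39Printed d c35 geo bg EK ∧ B9.RWKernelSumYields d geo bg EK Cinv := by
  obtain rfl : EK = fun i => EK39OfOpsBlkVia (𝔬 i) (rd i) d (2 * (N * B₀) * c₀') ((1 - α') * r) (π i) := funext hEK
  have hδ₀ : 0 < δ₀ := lt_of_lt_of_le hr hrδ
  have hδ₁ : 0 < (1 - α') * r := mul_pos (by linarith) hr
  have hB₁ : 0 ≤ 2 * (N * B₀) * c₀' := mul_nonneg (mul_nonneg zero_le_two (mul_nonneg hN hB₀.le)) hc₀'
  refine ⟨thm39Printed_of_local348BlkVia 𝔬 rd π c₀ c₀' d α α' r δ₀ θ₀ B₀ N a₁ M₁ ML hc₀ hc₀' h35 hα.le hα1 hα'1.le hr.le hrδ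
      hδ₀ hθ₀ hB₀ hN ha₁ hM₁ hst hloc hπlen hπl hπr h261 h39, ?_⟩
  exact rwKernelSumYields_of_conv348BlkVia 𝔬 Cinv d π hB₁ hδ₁ hcR (fun i y => (hst i).lenpos y) hπlen
    (fun i y y' => by rw [hπl, hπr]) (fun _ _ h => h) hrd

end Family

/-! ## §2 The J-indexed rows face at generic `(R₁, R₂, c)`: the display and the pin asked only along `f`, the (2.61) constants of the record family -/

section Along

open scoped Matrix.Norms.L2Operator

variable {N : ℕ} (θ : Stage3Params) (Mstar : ℕ) (𝔏 : LettersY N θ Mstar) (𝔈 : ExpsY N θ Mstar)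
variable [∀ x : MemberY θ.d₆ θ.ℓ₆ θ.hd' θ.hL' θ.b₀ θ.b₁ Mstar, Fintype (geo9Y x).Site]
  [∀ x : MemberY θ.d₆ θ.ℓ₆ θ.hd' θ.hL' θ.b₀ θ.b₁ Mstar, DecidableEq (geo9Y x).Site]
variable (R₁ R₂ : RegFamY θ.d₆ θ.ℓ₆ θ.hd' θ.hL' θ.b₀ θ.b₁ Mstar (Matrix (Fin N) (Fin N) ℂ))
variable (bI : ∀ x : MemberY θ.d₆ θ.ℓ₆ θ.hd' θ.hL' θ.b₀ θ.b₁ Mstar, FBondY x.toKIdx → IBondY x.toKIdx)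

omit [∀ x : MemberY θ.d₆ θ.ℓ₆ θ.hd' θ.hL' θ.b₀ θ.b₁ Mstar, DecidableEq (geo9Y x).Site] in
/-- **THE RECORD FAMILY's DEFINITE (2.61) CONSTANTS SERVE EVERY SUB-FAMILY**: for rates `αδ₀, α′r > 0` there is ONE threshold `ML` above which, at every
member `f j` of any sub-family `f : J → MemberY`, [4] (2.61) holds with the constants `rowConst261 geo9Y (αδ₀)`, `rowConst261 geo9Y (α′r)` chosen for the
WHOLE record family (`rowSum261_geo9Y` ∘ `ineq261With_pair_rowConst261_of_rowSum261`, read at `x := f j`).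
[cite: Balaban1984PropagatorsII, Lemma 2.1 (2.61) p.234 + (2.59) p.233] -/
theorem ineq261_pair_geo9Y_along {J : Type} (f : J → MemberY θ.d₆ θ.ℓ₆ θ.hd' θ.hL' θ.b₀ θ.b₁ Mstar) {α α' r δ₀ : ℝ}
    (hκ₁ : 0 < α * δ₀) (hκ₂ : 0 < α' * r) :
    ∃ ML : ℝ, ∀ j : J, ML ≤ (geo9Y (f j)).M →
      Ineq261With (B9RowSum261DefiniteFaces.rowConst261 (geo9Y (d := θ.d₆) (ℓ := θ.ℓ₆) (hd := θ.hd') (hL := θ.hL') (b₀ := θ.b₀) (b₁ := θ.b₁)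
          (Mstar := Mstar)) (α * δ₀)) (b6 (geo9Y (f j))) δ₀ α ∧
        Ineq261With (B9RowSum261DefiniteFaces.rowConst261 (geo9Y (d := θ.d₆) (ℓ := θ.ℓ₆) (hd := θ.hd') (hL := θ.hL') (b₀ := θ.b₀) (b₁ := θ.b₁)
          (Mstar := Mstar)) (α' * r)) (b6 (geo9Y (f j))) r α' := by
  obtain ⟨ML, h⟩ := B9RowSum261DefiniteFaces.ineq261With_pair_rowConst261_of_rowSum261
    (geo := geo9Y (d := θ.d₆) (ℓ := θ.ℓ₆) (hd := θ.hd') (hL := θ.hL') (b₀ := θ.b₀) (b₁ := θ.b₁) (Mstar := Mstar))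
    (fun _ => (0 : ℝ)) (fun _ => True) hκ₁ hκ₂ rowSum261_geo9Y
  exact ⟨ML, fun j hj => h (f j) hj⟩

/-- ★★ **THE J-INDEXED ROWS FACE — ROWS 15 ∧ 16 ALONG A SUB-FAMILY `f : J → MemberY` AT GENERIC `(R₁, R₂, c)` FROM THE DISPLAY AT ITS MEMBERS ONLY**:
`B9Thm39FacesAtLettersRC.t39_hksum_oneCube_opsYOfLetters_FRC` re-indexed at the source — IF at every member `f j` with `M₁ ≦ M`, every `α₀ > 0` with
`c·M·α₀ ≦ a₁` and every `U` with `(bg9YR … R₁ R₂ (f j)).Reg335 c α₀ U` the genuine `L39(U) = Q′G′²Q′*(U)` has a two-sided inverse with block majorant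
`B₀(Lʲη)⁻⁴e^{−δ₀d}` w.r.t. the faithful block map `blk39F (bI (f j))` (display `h348`, asked ALONG `f` ONLY), THEN — with the letter coherence `hC`, n06-i's
binder `hβI` and the `𝔈`-pin along `f` at the SAME constants `(2·(1·B₀)·rowConst261 geo9Y (α′r), (1−α′)r)` as the MemberY-indexed face — the two leaves
ALONG `f`: `B9.Thm39Printed (θ.d₆+1) c (geo9Y ∘ f) (bg9YR … R₁ R₂ ∘ f) (fun j => rwKernelExpansionR R₁ R₂ (ops (f j)).EK39) ∧ B9.RWKernelSumYields …` — verbatim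
what `B9KnitReindex.thm39Printed_reindex f` ∕ the kernel-sum re-indexing hand the coded knit, now WITHOUT the display at members outside the range of `f`.
[cite: Balaban1985BackgroundPropagators, Thm 3.9 (3.98)–(3.99) p.413 + Thm 3.2 (3.48) p.398 + (3.96) p.411 + (3.35) p.396 («c a number ≧ 10»); Balaban1984PropagatorsII, (2.45) p.231 + (2.51) p.232 + Lemma 2.1 (2.61) p.234 + p.248] -/
theorem t39_hksum_oneCube_opsYOfLetters_FRC_along {J : Type} (f : J → MemberY θ.d₆ θ.ℓ₆ θ.hd' θ.hL' θ.b₀ θ.b₁ Mstar)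
    (c α' r B₀ δ₀ a₁ M₁ : ℝ) (hc : 0 < c)
    (hα'0 : 0 < α') (hα'1 : α' < 1) (hr : 0 < r) (hrδ : r ≤ δ₀) (hB₀ : 0 < B₀) (ha₁ : 0 < a₁) (hM₁ : 0 < M₁)
    (h348 : ∀ j : J, M₁ ≤ (geo9Y (f j)).M → ∀ α₀ : ℝ, 0 < α₀ → c * (geo9Y (f j)).M * α₀ ≤ a₁ →
      ∀ U : (bg9YR (Matrix (Fin N) (Fin N) ℂ) (specialUnitaryUnits (Fin N)) R₁ R₂ (f j)).Cfg,
        (bg9YR (Matrix (Fin N) (Fin N) ℂ) (specialUnitaryUnits (Fin N)) R₁ R₂ (f j)).Reg335 c α₀ U →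
          Conv348Blk (oneCubeOps39YFR θ Mstar 𝔏 R₁ R₂ bI (f j)) B₀ δ₀ U)
    (hC : ∀ x : MemberY θ.d₆ θ.ℓ₆ θ.hd' θ.hL' θ.b₀ θ.b₁ Mstar, (𝔏 x).C = CY x.toKIdx (𝔏 x).parS (𝔏 x).Gp)
    (hβI : ∀ (x : MemberY θ.d₆ θ.ℓ₆ θ.hd' θ.hL' θ.b₀ θ.b₁ Mstar) (b : FBondY x.toKIdx) (c : IBondY x.toKIdx),
      blkV1 x.hN x.D b = β x.hN x.D x.hk c → β x.hN x.D x.hk (bI x b) = blkV1 x.hN x.D b)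
    (hEK39 : ∀ j : J,
      rwKernelExpansionR R₁ R₂ ((opsYOfLetters N θ Mstar 𝔏 𝔈) (f j)).EK39 =
      EK39OfOpsBlkVia (oneCubeOps39YFR θ Mstar 𝔏 R₁ R₂ bI (f j)) (oneCubeReading39 _) (θ.d₆ + 1)
        (2 * (1 * B₀) * B9RowSum261DefiniteFaces.rowConst261 (geo9Y (d := θ.d₆) (ℓ := θ.ℓ₆) (hd := θ.hd') (hL := θ.hL')
          (b₀ := θ.b₀) (b₁ := θ.b₁) (Mstar := Mstar)) (α' * r)) ((1 - α') * r) (repSite39F (f j).toKIdx (bI (f j)))) :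
    B9.Thm39Printed (θ.d₆ + 1) c (fun j => geo9Y (f j)) (fun j => bg9YR (Matrix (Fin N) (Fin N) ℂ) (specialUnitaryUnits (Fin N)) R₁ R₂ (f j))
        (fun j => rwKernelExpansionR R₁ R₂ ((opsYOfLetters N θ Mstar 𝔏 𝔈) (f j)).EK39) ∧
      B9.RWKernelSumYields (θ.d₆ + 1) (fun j => geo9Y (f j)) (fun j => bg9YR (Matrix (Fin N) (Fin N) ℂ) (specialUnitaryUnits (Fin N)) R₁ R₂ (f j))
        (fun j => rwKernelExpansionR R₁ R₂ ((opsYOfLetters N θ Mstar 𝔏 𝔈) (f j)).EK39)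
        (fun j => siteKernelR R₁ R₂ ((opsYOfLetters N θ Mstar 𝔏 𝔈) (f j)).Cinv) := by
  have hδ₀ : 0 < δ₀ := lt_of_lt_of_le hr hrδ
  obtain ⟨ML, h261⟩ := ineq261_pair_geo9Y_along θ Mstar f (α := 1 / 2) (α' := α') (r := r) (δ₀ := δ₀)
    (mul_pos one_half_pos hδ₀) (mul_pos hα'0 hr)
  exact thm39_and_kernelSum_of_pin_constBlkViaDatum (I := J) (geo := fun j => geo9Y (f j))
    (bg := fun j => bg9YR (Matrix (Fin N) (Fin N) ℂ) (specialUnitaryUnits (Fin N)) R₁ R₂ (f j))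
    (fun j => oneCubeOps39YFR θ Mstar 𝔏 R₁ R₂ bI (f j)) (fun _ => oneCubeReading39 _)
    (fun j => siteKernelR R₁ R₂ ((opsYOfLetters N θ Mstar 𝔏 𝔈) (f j)).Cinv) (θ.d₆ + 1) (fun j => repSite39F (f j).toKIdx (bI (f j)))
    (B9RowSum261DefiniteFaces.rowConst261 (geo9Y (d := θ.d₆) (ℓ := θ.ℓ₆) (hd := θ.hd') (hL := θ.hL') (b₀ := θ.b₀) (b₁ := θ.b₁) (Mstar := Mstar))
      (1 / 2 * δ₀))
    (B9RowSum261DefiniteFaces.rowConst261 (geo9Y (d := θ.d₆) (ℓ := θ.ℓ₆) (hd := θ.hd') (hL := θ.hL') (b₀ := θ.b₀) (b₁ := θ.b₁) (Mstar := Mstar))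
      (α' * r))
    (1 / 2) α' r δ₀ 0 B₀ 1 a₁ M₁ ML (cR39 (basis39 (Matrix (Fin N) (Fin N) ℂ)) * Fintype.card (κ39 (Matrix (Fin N) (Fin N) ℂ)))
    (B9RowSum261DefiniteFaces.rowConst261_nonneg _ _) (B9RowSum261DefiniteFaces.rowConst261_nonneg _ _) hc one_half_pos one_half_lt_one
    hα'1 hr hrδ le_rfl hB₀ zero_le_one ha₁ hM₁ (mul_nonneg (cR39_nonneg _) (Nat.cast_nonneg _))
    (fun j => staticOK39Blk_oneCube _ _ (geo9Y_dist_triangle (f j)) (geo9Y_dist_self (f j)) (geo9K_dist_nonneg' (f j).toKIdx) (geo9Y_len_pos (f j)))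
    (fun _ => locality39Blk_oneCube _ _)
    (fun j y => len_repSite39F (hβI (f j)) y) (fun j y z => dist_repSite39F_left (hβI (f j)) y z)
    (fun j z y => dist_repSite39F_right (hβI (f j)) z y) h261
    (fun j => kerReadsLeVia_opsYOfLettersR_F θ Mstar 𝔏 𝔈 R₁ R₂ bI hC (fun x => oneCubeOps39YFR θ Mstar 𝔏 R₁ R₂ bI x) (fun _ => rfl)
      (fun _ => rfl) (f j))
    (fun j hM α₀ hα ha U hU => schemas39_oneCube_of_conv348 _ _ r le_rfl (geo9Y_M_nonneg θ Mstar (f j)) (h348 j hM α₀ hα ha U hU))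
    hEK39

/-- **THEOREM 3.2 ALONG `f` FROM THE DISPLAY AT ITS MEMBERS** (p. 413 «This theorem implies Theorem 3.2»): `B9.Thm32Printed (θ.d₆+1) c (geo9Y ∘ f)
(bg9YR … R₁ R₂ ∘ f) (fun j => siteKernelR R₁ R₂ (ops (f j)).Cinv)` — the coded knit's `h32J` with no detour through the whole member type.
[cite: Balaban1985BackgroundPropagators, Thm 3.9 ⇒ Thm 3.2 p.413 + Thm 3.2 (3.48) p.398] -/
theorem thm32_oneCube_opsYOfLetters_FRC_along {J : Type} (f : J → MemberY θ.d₆ θ.ℓ₆ θ.hd' θ.hL' θ.b₀ θ.b₁ Mstar)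
    (c α' r B₀ δ₀ a₁ M₁ : ℝ) (hc : 0 < c)
    (hα'0 : 0 < α') (hα'1 : α' < 1) (hr : 0 < r) (hrδ : r ≤ δ₀) (hB₀ : 0 < B₀) (ha₁ : 0 < a₁) (hM₁ : 0 < M₁)
    (h348 : ∀ j : J, M₁ ≤ (geo9Y (f j)).M → ∀ α₀ : ℝ, 0 < α₀ → c * (geo9Y (f j)).M * α₀ ≤ a₁ →
      ∀ U : (bg9YR (Matrix (Fin N) (Fin N) ℂ) (specialUnitaryUnits (Fin N)) R₁ R₂ (f j)).Cfg,
        (bg9YR (Matrix (Fin N) (Fin N) ℂ) (specialUnitaryUnits (Fin N)) R₁ R₂ (f j)).Reg335 c α₀ U →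
          Conv348Blk (oneCubeOps39YFR θ Mstar 𝔏 R₁ R₂ bI (f j)) B₀ δ₀ U)
    (hC : ∀ x : MemberY θ.d₆ θ.ℓ₆ θ.hd' θ.hL' θ.b₀ θ.b₁ Mstar, (𝔏 x).C = CY x.toKIdx (𝔏 x).parS (𝔏 x).Gp)
    (hβI : ∀ (x : MemberY θ.d₆ θ.ℓ₆ θ.hd' θ.hL' θ.b₀ θ.b₁ Mstar) (b : FBondY x.toKIdx) (c : IBondY x.toKIdx),
      blkV1 x.hN x.D b = β x.hN x.D x.hk c → β x.hN x.D x.hk (bI x b) = blkV1 x.hN x.D b)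
    (hEK39 : ∀ j : J,
      rwKernelExpansionR R₁ R₂ ((opsYOfLetters N θ Mstar 𝔏 𝔈) (f j)).EK39 =
      EK39OfOpsBlkVia (oneCubeOps39YFR θ Mstar 𝔏 R₁ R₂ bI (f j)) (oneCubeReading39 _) (θ.d₆ + 1)
        (2 * (1 * B₀) * B9RowSum261DefiniteFaces.rowConst261 (geo9Y (d := θ.d₆) (ℓ := θ.ℓ₆) (hd := θ.hd') (hL := θ.hL')
          (b₀ := θ.b₀) (b₁ := θ.b₁) (Mstar := Mstar)) (α' * r)) ((1 - α') * r) (repSite39F (f j).toKIdx (bI (f j)))) :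
    B9.Thm32Printed (θ.d₆ + 1) c (fun j => geo9Y (f j)) (fun j => bg9YR (Matrix (Fin N) (Fin N) ℂ) (specialUnitaryUnits (Fin N)) R₁ R₂ (f j))
      (fun j => siteKernelR R₁ R₂ ((opsYOfLetters N θ Mstar 𝔏 𝔈) (f j)).Cinv) := by
  obtain ⟨h39, hks⟩ := t39_hksum_oneCube_opsYOfLetters_FRC_along θ Mstar 𝔏 𝔈 R₁ R₂ bI f c α' r B₀ δ₀ a₁ M₁ hc hα'0 hα'1 hr hrδ hB₀ ha₁
    hM₁ h348 hC hβI hEK39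
  exact B9.thm32_of_thm39 (θ.d₆ + 1) c _ _ _ _ h39 hks

end Along

/-! ## §3 ★★★ The display DISCHARGED along every section-carrying sub-family: rows 15 ∧ 16 and Theorem 3.2 as THEOREMS along `(f, ιB, hι)` -/

section Sections

open scoped Matrix.Norms.L2Operator

variable {N : ℕ} (θ : Stage3Params) (Mstar : ℕ)
variable [∀ x : MemberY θ.d₆ θ.ℓ₆ θ.hd' θ.hL' θ.b₀ θ.b₁ Mstar, Fintype (geo9Y x).Site]
  [∀ x : MemberY θ.d₆ θ.ℓ₆ θ.hd' θ.hL' θ.b₀ θ.b₁ Mstar, DecidableEq (geo9Y x).Site]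

/-- ★★★ **ROWS 15 ∧ 16 HOLD ALONG EVERY SECTION-CARRYING SUB-FAMILY, AT THE LETTERS OF RECORD, ON THE CERTIFICATE's R-CLASS** — the J-indexed rows face
with its display `h348` DISCHARGED by this seat's `conv348_oneCubeYF_of_regYR_section` (lit-balaban's Theorem 3.2 member assembler on print's class): for
every regularity pair `(R₁, R₂)` whose first family lands in print's class (3.35) at rate `c₃₅` (the certificate's own transfer `hRP1`), every `c > 0` and
`N ≧ 1`, there are `B₀, δ₀ > 0` such that for all rates `0 < α′ < 1`, `0 < r ≦ δ₀`, every residual letter `𝔯`, every expansion record `𝔈`, every bond map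
`bI` with n06-i's `hβI`, and EVERY sub-family `f : J → MemberY` CARRYING SECTIONS `ιB j` of `β` (`hι`), the `𝔈`-pin along `f` at the constants
`(2·(1·B₀)·rowConst261 geo9Y (α′r), (1−α′)r)` alone yields the two leaves along `f` at class constant `c`:
`B9.Thm39Printed (θ.d₆+1) c (geo9Y ∘ f) (bg9YR … R₁ R₂ ∘ f) (EK39 ∘ f) ∧ B9.RWKernelSumYields …` — NO `h348`, no regime letters.  (At inner-corner members —
no section — the display stays displayed: lit-balaban's binder `hι`.)
[cite: Balaban1985BackgroundPropagators, Thm 3.9 (3.98)–(3.99) p.413 + Thm 3.2 (3.48) p.398 + (3.96) p.411 + (3.35) p.396; Balaban1984PropagatorsII, (2.45) p.231 + (2.51) p.232 + Lemma 2.1 (2.61) p.234 + (2.86)–(2.87) p.238 + p.248] -/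
theorem t39_hksum_along_sections_of_regYR (hN : 1 ≤ N)
    {R₁ R₂ : RegFamY θ.d₆ θ.ℓ₆ θ.hd' θ.hL' θ.b₀ θ.b₁ Mstar (Matrix (Fin N) (Fin N) ℂ)} {c : ℝ} (hc : 0 < c)
    (hRP1 : ∀ (x : MemberY θ.d₆ θ.ℓ₆ θ.hd' θ.hL' θ.b₀ θ.b₁ Mstar) (α₀ : ℝ)
      (U : (bg9YR (Matrix (Fin N) (Fin N) ℂ) (specialUnitaryUnits (Fin N)) R₁ R₂ x).Cfg),
      (bg9YR (Matrix (Fin N) (Fin N) ℂ) (specialUnitaryUnits (Fin N)) R₁ R₂ x).Reg335 c α₀ U →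
        0 ≤ α₀ ∧ (bg9YP (Matrix (Fin N) (Fin N) ℂ) (specialUnitaryUnits (Fin N)) x).Reg335 c35Y α₀ U) :
    ∃ B₀ δ₀ : ℝ, 0 < B₀ ∧ 0 < δ₀ ∧
    ∀ (α' r : ℝ), 0 < α' → α' < 1 → 0 < r → r ≤ δ₀ →
    ∀ (𝔯 : ResY N θ Mstar) (𝔈 : ExpsY N θ Mstar)
      (bI : ∀ x : MemberY θ.d₆ θ.ℓ₆ θ.hd' θ.hL' θ.b₀ θ.b₁ Mstar, FBondY x.toKIdx → IBondY x.toKIdx)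
      (_hβI : ∀ (x : MemberY θ.d₆ θ.ℓ₆ θ.hd' θ.hL' θ.b₀ θ.b₁ Mstar) (b : FBondY x.toKIdx) (c : IBondY x.toKIdx),
        blkV1 x.hN x.D b = β x.hN x.D x.hk c → β x.hN x.D x.hk (bI x b) = blkV1 x.hN x.D b)
      {J : Type} (f : J → MemberY θ.d₆ θ.ℓ₆ θ.hd' θ.hL' θ.b₀ θ.b₁ Mstar) (ιB : ∀ j : J, BlkY (f j).toKIdx → IBondY (f j).toKIdx)
      (_hι : ∀ (j : J) (s : BlkY (f j).toKIdx), β (f j).toKIdx.hN (f j).toKIdx.D (f j).toKIdx.hk (ιB j s) = s),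
      (∀ j : J, rwKernelExpansionR R₁ R₂ ((opsYOfLetters N θ Mstar (lettersYOfRecordV4P N θ Mstar 𝔯) 𝔈) (f j)).EK39 =
        EK39OfOpsBlkVia (oneCubeOps39YFR θ Mstar (lettersYOfRecordV4P N θ Mstar 𝔯) R₁ R₂ bI (f j)) (oneCubeReading39 _) (θ.d₆ + 1)
          (2 * (1 * B₀) * B9RowSum261DefiniteFaces.rowConst261 (geo9Y (d := θ.d₆) (ℓ := θ.ℓ₆) (hd := θ.hd') (hL := θ.hL')
            (b₀ := θ.b₀) (b₁ := θ.b₁) (Mstar := Mstar)) (α' * r)) ((1 - α') * r) (repSite39F (f j).toKIdx (bI (f j)))) →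
      B9.Thm39Printed (θ.d₆ + 1) c (fun j => geo9Y (f j)) (fun j => bg9YR (Matrix (Fin N) (Fin N) ℂ) (specialUnitaryUnits (Fin N)) R₁ R₂ (f j))
          (fun j => rwKernelExpansionR R₁ R₂ ((opsYOfLetters N θ Mstar (lettersYOfRecordV4P N θ Mstar 𝔯) 𝔈) (f j)).EK39) ∧
        B9.RWKernelSumYields (θ.d₆ + 1) (fun j => geo9Y (f j))
          (fun j => bg9YR (Matrix (Fin N) (Fin N) ℂ) (specialUnitaryUnits (Fin N)) R₁ R₂ (f j))
          (fun j => rwKernelExpansionR R₁ R₂ ((opsYOfLetters N θ Mstar (lettersYOfRecordV4P N θ Mstar 𝔯) 𝔈) (f j)).EK39)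
          (fun j => siteKernelR R₁ R₂ ((opsYOfLetters N θ Mstar (lettersYOfRecordV4P N θ Mstar 𝔯) 𝔈) (f j)).Cinv) := by
  obtain ⟨M₁, a₁, B₀, δ₀, hM₁, ha₁, hB₀, hδ₀, H⟩ := conv348_oneCubeYF_of_regYR_section (N := N) θ Mstar hN hc hRP1
  refine ⟨B₀, δ₀, hB₀, hδ₀, fun α' r hα'0 hα'1 hr hrδ 𝔯 𝔈 bI hβI J f ιB hι hEK39 => ?_⟩
  exact t39_hksum_oneCube_opsYOfLetters_FRC_along θ Mstar (lettersYOfRecordV4P N θ Mstar 𝔯) 𝔈 R₁ R₂ bI f c α' r B₀ δ₀ a₁ M₁ hc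
    hα'0 hα'1 hr hrδ hB₀ ha₁ hM₁
    (fun j hM α₀ hα ha U hU =>
      (conv348Blk_oneCubeYFR_iff θ Mstar (lettersYOfRecordV4P N θ Mstar 𝔯) R₁ R₂ bI (f j) B₀ δ₀ U).2
        (H 𝔯 bI hβI (f j) (fun s => ⟨ιB j s, hι j s⟩) hM α₀ hα ha U hU))
    (fun _ => rfl) hβI hEK39

/-- ★★★ **THEOREM 3.2 HOLDS ALONG EVERY SECTION-CARRYING SUB-FAMILY** (same data; p. 413 «This theorem implies Theorem 3.2»):
`B9.Thm32Printed (θ.d₆+1) c (geo9Y ∘ f) (bg9YR … R₁ R₂ ∘ f) (fun j => siteKernelR R₁ R₂ (ops (f j)).Cinv)` from the `𝔈`-pin along `f` alone.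
[cite: Balaban1985BackgroundPropagators, Thm 3.2 (3.48) p.398 + Thm 3.9 p.413 + (3.35) p.396; Balaban1984PropagatorsII, (2.45) p.231 + (2.86)–(2.87) p.238] -/
theorem thm32_along_sections_of_regYR (hN : 1 ≤ N)
    {R₁ R₂ : RegFamY θ.d₆ θ.ℓ₆ θ.hd' θ.hL' θ.b₀ θ.b₁ Mstar (Matrix (Fin N) (Fin N) ℂ)} {c : ℝ} (hc : 0 < c)
    (hRP1 : ∀ (x : MemberY θ.d₆ θ.ℓ₆ θ.hd' θ.hL' θ.b₀ θ.b₁ Mstar) (α₀ : ℝ)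
      (U : (bg9YR (Matrix (Fin N) (Fin N) ℂ) (specialUnitaryUnits (Fin N)) R₁ R₂ x).Cfg),
      (bg9YR (Matrix (Fin N) (Fin N) ℂ) (specialUnitaryUnits (Fin N)) R₁ R₂ x).Reg335 c α₀ U →
        0 ≤ α₀ ∧ (bg9YP (Matrix (Fin N) (Fin N) ℂ) (specialUnitaryUnits (Fin N)) x).Reg335 c35Y α₀ U) :
    ∃ B₀ δ₀ : ℝ, 0 < B₀ ∧ 0 < δ₀ ∧
    ∀ (α' r : ℝ), 0 < α' → α' < 1 → 0 < r → r ≤ δ₀ →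
    ∀ (𝔯 : ResY N θ Mstar) (𝔈 : ExpsY N θ Mstar)
      (bI : ∀ x : MemberY θ.d₆ θ.ℓ₆ θ.hd' θ.hL' θ.b₀ θ.b₁ Mstar, FBondY x.toKIdx → IBondY x.toKIdx)
      (_hβI : ∀ (x : MemberY θ.d₆ θ.ℓ₆ θ.hd' θ.hL' θ.b₀ θ.b₁ Mstar) (b : FBondY x.toKIdx) (c : IBondY x.toKIdx),
        blkV1 x.hN x.D b = β x.hN x.D x.hk c → β x.hN x.D x.hk (bI x b) = blkV1 x.hN x.D b)
      {J : Type} (f : J → MemberY θ.d₆ θ.ℓ₆ θ.hd' θ.hL' θ.b₀ θ.b₁ Mstar) (ιB : ∀ j : J, BlkY (f j).toKIdx → IBondY (f j).toKIdx)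
      (_hι : ∀ (j : J) (s : BlkY (f j).toKIdx), β (f j).toKIdx.hN (f j).toKIdx.D (f j).toKIdx.hk (ιB j s) = s),
      (∀ j : J, rwKernelExpansionR R₁ R₂ ((opsYOfLetters N θ Mstar (lettersYOfRecordV4P N θ Mstar 𝔯) 𝔈) (f j)).EK39 =
        EK39OfOpsBlkVia (oneCubeOps39YFR θ Mstar (lettersYOfRecordV4P N θ Mstar 𝔯) R₁ R₂ bI (f j)) (oneCubeReading39 _) (θ.d₆ + 1)
          (2 * (1 * B₀) * B9RowSum261DefiniteFaces.rowConst261 (geo9Y (d := θ.d₆) (ℓ := θ.ℓ₆) (hd := θ.hd') (hL := θ.hL')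
            (b₀ := θ.b₀) (b₁ := θ.b₁) (Mstar := Mstar)) (α' * r)) ((1 - α') * r) (repSite39F (f j).toKIdx (bI (f j)))) →
      B9.Thm32Printed (θ.d₆ + 1) c (fun j => geo9Y (f j)) (fun j => bg9YR (Matrix (Fin N) (Fin N) ℂ) (specialUnitaryUnits (Fin N)) R₁ R₂ (f j))
        (fun j => siteKernelR R₁ R₂ ((opsYOfLetters N θ Mstar (lettersYOfRecordV4P N θ Mstar 𝔯) 𝔈) (f j)).Cinv) := by
  obtain ⟨B₀, δ₀, hB₀, hδ₀, H⟩ := t39_hksum_along_sections_of_regYR (N := N) θ Mstar hN hc hRP1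
  refine ⟨B₀, δ₀, hB₀, hδ₀, fun α' r hα'0 hα'1 hr hrδ 𝔯 𝔈 bI hβI J f ιB hι hEK39 => ?_⟩
  obtain ⟨h39, hks⟩ := H α' r hα'0 hα'1 hr hrδ 𝔯 𝔈 bI hβI f ιB hι hEK39
  exact B9.thm32_of_thm39 (θ.d₆ + 1) c _ _ _ _ h39 hks

/-! ## §4 AT THE SECTION-CARRYING SUB-FAMILY BY NAME (director-ym №300 «INHABITED BY:» — n06-c's carrier `B9SectionCarryingMembersV1.SCMemberY`) -/

/-- ★★★ **ROWS 15 ∧ 16 ALONG n06-c's CARRIER `SCMemberY` BY NAME** (`J := SCMemberY …`, `f := SCMemberY.val`, sections `SCMemberY.ιBsc ∕ hιsc` by construction;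
INHABITED BY `SCMemberY.nonempty` ∕ `exists_scMember_ge` — members beyond every threshold): the two leaves along `SCMemberY.val` at class constant `c` from
the `𝔈`-pin alone, for all rates `0 < α′ < 1`, `0 < r ≦ δ₀`.
[cite: Balaban1985BackgroundPropagators, Thm 3.9 (3.98)–(3.99) p.413 + Thm 3.2 (3.48) p.398 + (3.35) p.396; Balaban1984PropagatorsII, (2.3) p.224 + (2.45) p.231 + p.248] -/
theorem t39_hksum_at_scMemberY_of_regYR (hN : 1 ≤ N)
    {R₁ R₂ : RegFamY θ.d₆ θ.ℓ₆ θ.hd' θ.hL' θ.b₀ θ.b₁ Mstar (Matrix (Fin N) (Fin N) ℂ)} {c : ℝ} (hc : 0 < c)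
    (hRP1 : ∀ (x : MemberY θ.d₆ θ.ℓ₆ θ.hd' θ.hL' θ.b₀ θ.b₁ Mstar) (α₀ : ℝ)
      (U : (bg9YR (Matrix (Fin N) (Fin N) ℂ) (specialUnitaryUnits (Fin N)) R₁ R₂ x).Cfg),
      (bg9YR (Matrix (Fin N) (Fin N) ℂ) (specialUnitaryUnits (Fin N)) R₁ R₂ x).Reg335 c α₀ U →
        0 ≤ α₀ ∧ (bg9YP (Matrix (Fin N) (Fin N) ℂ) (specialUnitaryUnits (Fin N)) x).Reg335 c35Y α₀ U) :
    ∃ B₀ δ₀ : ℝ, 0 < B₀ ∧ 0 < δ₀ ∧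
    ∀ (α' r : ℝ), 0 < α' → α' < 1 → 0 < r → r ≤ δ₀ →
    ∀ (𝔯 : ResY N θ Mstar) (𝔈 : ExpsY N θ Mstar)
      (bI : ∀ x : MemberY θ.d₆ θ.ℓ₆ θ.hd' θ.hL' θ.b₀ θ.b₁ Mstar, FBondY x.toKIdx → IBondY x.toKIdx)
      (_hβI : ∀ (x : MemberY θ.d₆ θ.ℓ₆ θ.hd' θ.hL' θ.b₀ θ.b₁ Mstar) (b : FBondY x.toKIdx) (c : IBondY x.toKIdx),
        blkV1 x.hN x.D b = β x.hN x.D x.hk c → β x.hN x.D x.hk (bI x b) = blkV1 x.hN x.D b),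
      (∀ j : SCMemberY θ.d₆ θ.ℓ₆ θ.hd' θ.hL' θ.b₀ θ.b₁ Mstar,
        rwKernelExpansionR R₁ R₂ ((opsYOfLetters N θ Mstar (lettersYOfRecordV4P N θ Mstar 𝔯) 𝔈) j.val).EK39 =
        EK39OfOpsBlkVia (oneCubeOps39YFR θ Mstar (lettersYOfRecordV4P N θ Mstar 𝔯) R₁ R₂ bI j.val) (oneCubeReading39 _) (θ.d₆ + 1)
          (2 * (1 * B₀) * B9RowSum261DefiniteFaces.rowConst261 (geo9Y (d := θ.d₆) (ℓ := θ.ℓ₆) (hd := θ.hd') (hL := θ.hL')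
            (b₀ := θ.b₀) (b₁ := θ.b₁) (Mstar := Mstar)) (α' * r)) ((1 - α') * r) (repSite39F j.val.toKIdx (bI j.val))) →
      B9.Thm39Printed (θ.d₆ + 1) c (fun j : SCMemberY θ.d₆ θ.ℓ₆ θ.hd' θ.hL' θ.b₀ θ.b₁ Mstar => geo9Y j.val)
          (fun j => bg9YR (Matrix (Fin N) (Fin N) ℂ) (specialUnitaryUnits (Fin N)) R₁ R₂ j.val)
          (fun j => rwKernelExpansionR R₁ R₂ ((opsYOfLetters N θ Mstar (lettersYOfRecordV4P N θ Mstar 𝔯) 𝔈) j.val).EK39) ∧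
        B9.RWKernelSumYields (θ.d₆ + 1) (fun j : SCMemberY θ.d₆ θ.ℓ₆ θ.hd' θ.hL' θ.b₀ θ.b₁ Mstar => geo9Y j.val)
          (fun j => bg9YR (Matrix (Fin N) (Fin N) ℂ) (specialUnitaryUnits (Fin N)) R₁ R₂ j.val)
          (fun j => rwKernelExpansionR R₁ R₂ ((opsYOfLetters N θ Mstar (lettersYOfRecordV4P N θ Mstar 𝔯) 𝔈) j.val).EK39)
          (fun j => siteKernelR R₁ R₂ ((opsYOfLetters N θ Mstar (lettersYOfRecordV4P N θ Mstar 𝔯) 𝔈) j.val).Cinv) := by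
  obtain ⟨B₀, δ₀, hB₀, hδ₀, H⟩ := t39_hksum_along_sections_of_regYR (N := N) θ Mstar hN hc hRP1
  exact ⟨B₀, δ₀, hB₀, hδ₀, fun α' r hα'0 hα'1 hr hrδ 𝔯 𝔈 bI hβI hEK39 =>
    H α' r hα'0 hα'1 hr hrδ 𝔯 𝔈 bI hβI SCMemberY.val SCMemberY.ιBsc SCMemberY.hιsc hEK39⟩

/-- ★★★ **THEOREM 3.2 ALONG n06-c's CARRIER `SCMemberY` BY NAME**: `B9.Thm32Printed (θ.d₆+1) c (geo9Y ∘ SCMemberY.val) (bg9YR … R₁ R₂ ∘ SCMemberY.val)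
(fun j => siteKernelR R₁ R₂ (ops j.val).Cinv)` from the `𝔈`-pin alone (INHABITED BY `SCMemberY.nonempty`).
[cite: Balaban1985BackgroundPropagators, Thm 3.2 (3.48) p.398 + Thm 3.9 p.413; Balaban1984PropagatorsII, (2.45) p.231 + (2.86)–(2.87) p.238] -/
theorem thm32_at_scMemberY_of_regYR (hN : 1 ≤ N)
    {R₁ R₂ : RegFamY θ.d₆ θ.ℓ₆ θ.hd' θ.hL' θ.b₀ θ.b₁ Mstar (Matrix (Fin N) (Fin N) ℂ)} {c : ℝ} (hc : 0 < c)
    (hRP1 : ∀ (x : MemberY θ.d₆ θ.ℓ₆ θ.hd' θ.hL' θ.b₀ θ.b₁ Mstar) (α₀ : ℝ)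
      (U : (bg9YR (Matrix (Fin N) (Fin N) ℂ) (specialUnitaryUnits (Fin N)) R₁ R₂ x).Cfg),
      (bg9YR (Matrix (Fin N) (Fin N) ℂ) (specialUnitaryUnits (Fin N)) R₁ R₂ x).Reg335 c α₀ U →
        0 ≤ α₀ ∧ (bg9YP (Matrix (Fin N) (Fin N) ℂ) (specialUnitaryUnits (Fin N)) x).Reg335 c35Y α₀ U) :
    ∃ B₀ δ₀ : ℝ, 0 < B₀ ∧ 0 < δ₀ ∧
    ∀ (α' r : ℝ), 0 < α' → α' < 1 → 0 < r → r ≤ δ₀ →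
    ∀ (𝔯 : ResY N θ Mstar) (𝔈 : ExpsY N θ Mstar)
      (bI : ∀ x : MemberY θ.d₆ θ.ℓ₆ θ.hd' θ.hL' θ.b₀ θ.b₁ Mstar, FBondY x.toKIdx → IBondY x.toKIdx)
      (_hβI : ∀ (x : MemberY θ.d₆ θ.ℓ₆ θ.hd' θ.hL' θ.b₀ θ.b₁ Mstar) (b : FBondY x.toKIdx) (c : IBondY x.toKIdx),
        blkV1 x.hN x.D b = β x.hN x.D x.hk c → β x.hN x.D x.hk (bI x b) = blkV1 x.hN x.D b),
      (∀ j : SCMemberY θ.d₆ θ.ℓ₆ θ.hd' θ.hL' θ.b₀ θ.b₁ Mstar,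
        rwKernelExpansionR R₁ R₂ ((opsYOfLetters N θ Mstar (lettersYOfRecordV4P N θ Mstar 𝔯) 𝔈) j.val).EK39 =
        EK39OfOpsBlkVia (oneCubeOps39YFR θ Mstar (lettersYOfRecordV4P N θ Mstar 𝔯) R₁ R₂ bI j.val) (oneCubeReading39 _) (θ.d₆ + 1)
          (2 * (1 * B₀) * B9RowSum261DefiniteFaces.rowConst261 (geo9Y (d := θ.d₆) (ℓ := θ.ℓ₆) (hd := θ.hd') (hL := θ.hL')
            (b₀ := θ.b₀) (b₁ := θ.b₁) (Mstar := Mstar)) (α' * r)) ((1 - α') * r) (repSite39F j.val.toKIdx (bI j.val))) →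
      B9.Thm32Printed (θ.d₆ + 1) c (fun j : SCMemberY θ.d₆ θ.ℓ₆ θ.hd' θ.hL' θ.b₀ θ.b₁ Mstar => geo9Y j.val)
        (fun j => bg9YR (Matrix (Fin N) (Fin N) ℂ) (specialUnitaryUnits (Fin N)) R₁ R₂ j.val)
        (fun j => siteKernelR R₁ R₂ ((opsYOfLetters N θ Mstar (lettersYOfRecordV4P N θ Mstar 𝔯) 𝔈) j.val).Cinv) := by
  obtain ⟨B₀, δ₀, hB₀, hδ₀, H⟩ := thm32_along_sections_of_regYR (N := N) θ Mstar hN hc hRP1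
  exact ⟨B₀, δ₀, hB₀, hδ₀, fun α' r hα'0 hα'1 hr hrδ 𝔯 𝔈 bI hβI hEK39 =>
    H α' r hα'0 hα'1 hr hrδ 𝔯 𝔈 bI hβI SCMemberY.val SCMemberY.ιBsc SCMemberY.hιsc hEK39⟩

end Sections

end Literature.MathematicalPhysics.QuantumFieldTheory.Balaban1983to89.B9Thm39FacesAlongSubfamilyRC

end
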